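import Summits.BirchSwinnertonDyer.BirchSwinnertonDyer.Theorems.ByReductionTypeAtTwoOrdKatoHalfAtTwoIsoZetaColemanMuIotaAssembly
import Summits.BirchSwinnertonDyer.BirchSwinnertonDyer.Theorems.ByReductionTypeAtTwoOrdKatoHalfAtTwoIsoPosDiscSplit
import HarnessLib

/-!
# Route ByReductionTypeAtTwo, crux `OrdKatoHalfAtTwoIso` (stmt-BirchSwinnertonDyer-19573), line `steinberg-fibre-at-two`,
# F1 slot (child stmt-BirchSwinnertonDyer-23959): the HONEST local inputs at `2`, restricted to the `Δ < 0` cell, supply the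
# LEAD's displayed text `ZetaColemanMuIotaNegDiscAtTwo` (F1μι⁻, p693557) BY NAME — and, through the split glue p-tree
# `ordKatoHalfAtTwoIso_of_iota_halves`, the crux BY NAME

Seat `cruxlead-stmt-BirchSwinnertonDyer-19573-w3` g3 (prover WIDTH under the LEAD `cruxlead-19573` g5; HOME
`run/shared/lean/pub/bsd-2adic/`; `--supports` stmt-BirchSwinnertonDyer-23959; the LEAD's RELINE-posDisc order of events, step 4:
«w3's `…IotaAssembly` supplies `ZetaColemanMuIotaNegDiscAtTwo` BY NAME (one writer: the def is the lead's, the supply is w3's)»).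
THEOREMS ONLY (no definition, no named fact, no `sorry`, no instance). HONEST FRAMING (cell bsd-2adic): BSD is not proved by any
of this; F1μι⁻, the direct `0 < Δ` child, B7′ and the crux are NOT proved here; every theorem is a KERNEL implication over
explicit hypotheses.

WHY THE `Δ < 0` RESTRICTION IS THE HONEST PRIMITIVE. The sign-free honest supply `hhonest` of `…IotaAssembly` (p693362) carries the
explicit-reciprocity-law clause `‖r‖₂ = 1` for the period ratio `r`; by the lead's finding F-27a (`Cruxes/OrdKatoHalfAtTwoIso/
LEAD-FINDING-F27a-posDisc.md`) that clause is Kato-witnessed on a RHOMBIC period lattice (`Δ < 0`, the class of `γ = γ₁^∨`) and has NO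
Kato witness on a rectangular one (`0 < Δ`, every class booked at `2·L₂^{tree}`, `‖r‖₂ = 2⁻¹`-off). So the supply one can hope to TYPE is
the `Δ < 0`-restricted one, `hhonestNeg` below (= `hhonest` with the binder `W.Δ < 0 →` inserted after `ρ̄₂` onto), and this file shows it is
exactly what the P8′ F1 conjunct needs.

* §1 `zetaColemanMuIotaNegDiscAtTwo_of_honestLocalDualPairs_negDisc` — `hhonestNeg` ⇒ `ZetaColemanMuIotaNegDiscAtTwo` (per datum via
  p693362 `zetaColemanMuTheta_invol_datum_of_localDualPair_locOne_erl`); `…_of_honestLocalDualPairs` — the sign-free `hhonest` ⇒ the same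
  (monotone, through `zetaColemanMuTheta_invol_of_honestLocalDualPairs` and the lead's `zetaColemanMuIotaNegDiscAtTwo_of_iota_signFree`).
* §2 consequences BY NAME on the `Δ < 0` cell from `hhonestNeg`: `μ(X) = 0` per datum, Kato's `μ`-part, and the crux
  `OrdKatoHalfAtTwoIso` in the P8′ split-glue shape (`hhonestNeg`, the direct `0 < Δ` child, the print bundle, B7′).

References: [Kato2004Asterisque] Thm 12.6 (p. 222), (14.9.3) (p. 240), Thm 16.2 (p. 269), Thm 16.6 (2) (p. 271), Thm 17.4 (1)(2)
(p. 273), 17.5 (p. 274), Prop 17.11 (p. 277), §17.13 (pp. 279–280); [MilneADT2006] I Cor. 2.3; [GreenbergLNM1716] §2 Prop 2.1, Prop 5.14;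
[AbbesUllmo1996] Thm A; tree p693362 (`…IotaAssembly`), p693557 (`…PosDiscDefs`), `…PosDiscSplit` (lead g5), p690167, p691807.
-/

set_option autoImplicit false
set_option linter.dupNamespace false

noncomputable section

open scoped Classical MatrixGroups ModularForm NumberField
open CongruenceSubgroup WeierstrassCurve Field IsDedekindDomain NumberField
open Literature.NumberTheory.GaloisRepresentations
open Literature.NumberTheory.GaloisCohomology
open Literature.NumberTheory.EllipticCurves Literature.NumberTheory.EllipticCurves.ModularForms
  Literature.NumberTheory.EllipticCurves.GreenbergSelmer
open Literature.NumberTheory.EllipticCurves.Kato2004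
  Literature.NumberTheory.EllipticCurves.Kato2004.EulerSystemValues
open Literature.NumberTheory.EllipticCurves.IwasawaDual
open Literature.NumberTheory.EllipticCurves.Rank1Residual
open Literature.NumberTheory.EllipticCurves.Greenberg1999
open Summit.BirchSwinnertonDyer.Rank1Residual Summit.BirchSwinnertonDyer.Rank1Residual.X5
open Summit.BirchSwinnertonDyer.BirchSwinnertonDyer.Theorems.OrdKatoOptimalAtTwo
  Summit.BirchSwinnertonDyer.BirchSwinnertonDyer.Theorems.OrdKatoIntAtTwo
open Summit.BirchSwinnertonDyer.BirchSwinnertonDyer.Theses.ByReductionTypeAtTwo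

namespace Summit.BirchSwinnertonDyer.BirchSwinnertonDyer.Theorems.SteinbergFibreAtTwo

/-! ## §1 The honest supply on the `Δ < 0` cell gives F1μι⁻ BY NAME -/

section HonestNeg

/- The HONEST ∀-supply RESTRICTED TO `Δ < 0`: for every `W` on the cell «good ordinary at `2`, `ρ̄₂` onto, `Δ_W < 0`», newform `f`,
cyclotomic `(κ, γ)` and Selmer dual datum `D` — the pinned `𝐇¹`, a set `G` of genuine `2`-adic classes, a place `v₂ ∋ 2`, (L′) a local
Coleman dual pair at `2` KEYED BY `ψ⁻` with an inverse key `ψ`, injective `col`, `φ` intertwining `ψ` with kernel at `v₂`, (R) on `G`,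
(E) the ERL shape with `‖r‖₂ = 1` (F-27a: the rhombic lattice). A hypothesis (the typed inputs at `2`), not a definition; it is the
`hhonest` of p693362 with ONE extra binder `W.Δ < 0 →`. -/
variable (hhonestNeg : ∀ (W : WeierstrassCurve ℚ) [W.IsElliptic] [W.IsGloballyMinimal]
    [ContinuousSMul ℤ_[2] (W.tateModule 2)] [Module.Free ℤ_[2] (W.tateModule 2)]
    [Module.Finite ℤ_[2] (W.tateModule 2)] {N : ℕ} [NeZero N] (f : CuspForm (Gamma0 N) 2)
    (κ : ZpExtension ℚ 2) (γ : absoluteGaloisGroup ℚ) (hκ : κ.IsCyclotomic),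
    IsOrdinaryAt W 2 → W.HasSurjectiveModNGaloisRep 2 → W.Δ < 0 →
    κ.IsTopGenerator γ → IsCyclotomicVariable 2 γ → IsNewformOf W f →
    ∀ (D : W.SelmerDualData κ γ),
      ∃ (I : IwasawaH1Data W 2 κ γ) (G : Set I.H)
        (v₂ : HeightOneSpectrum (𝓞 ℚ)) (_ : ((2 : ℕ) : 𝓞 ℚ) ∈ v₂.asIdeal)
        (P₀ : Type) (_ : AddCommGroup P₀) (_ : Module (IwasawaAlgebra 2) P₀)
        (S : Type) (_ : AddCommGroup S) (ψm ψ : AddMonoid.End S) (toDualP : P₀ →+ (S →+ AddCircle (1 : ℚ)))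
        (col : P₀ →ₗ[IwasawaAlgebra 2] IwasawaAlgebra 2) (φ : W.selmerInfty κ →+ S)
        (ℓ₀ : I.H →ₗ[IwasawaAlgebra 2] P₀),
        (∀ g ∈ G, IsEulerSystemClassTwo W hκ I g) ∧
        IsDualPair 2 ψm toDualP ∧ (1 + ψm) * (1 + ψ) = 1 ∧ (1 + ψ) * (1 + ψm) = 1 ∧
        Function.Injective col ∧
        (∀ s, φ ((W.conjSelmerInfty κ γ - 1) s) = ψ (φ s)) ∧
        (∀ s : W.selmerInfty κ, φ s = 0 ↔
          W.resOfLe 2 (inf_le_left : κ.kerSubgroup ⊓ decomp v₂ ≤ κ.kerSubgroup)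
            (s : W.subgroupH1 2 κ.kerSubgroup) = 0) ∧
        (∀ g ∈ G, ∀ s : W.selmerInfty κ, toDualP (ℓ₀ g) (φ s) = 0) ∧
        ∃ g ∈ G, ∃ (u : (IwasawaAlgebra 2)ˣ) (M L' : IwasawaAlgebra 2) (r : ℚ_[2]),
          M ∉ IwasawaAlgebra.augIdealP 2 ∧ ‖r‖ = 1 ∧
            iwasawaToPowerSeries 2 L' = PowerSeries.C r * padicLFunction f (unitRoot W 2 : ℚ_[2]) ∧
            col (ℓ₀ g) = (u : IwasawaAlgebra 2) * M * L')

include hhonestNeg in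
/-- **The honest `Δ < 0` supply gives F1μι⁻ = `ZetaColemanMuIotaNegDiscAtTwo` BY NAME** (the lead's displayed text, p693557; the P8′
F1 conjunct). Per datum this is p693362 `zetaColemanMuTheta_invol_datum_of_localDualPair_locOne_erl` (`P := range col`, `ℓ := col ∘ ℓ₀`,
`τ := F ∘ col⁻¹` with `F` the `ι`-semilinear transpose of `φ = loc₂`, `π` the canonical fine quotient). Kernel; the supply is the
OPEN content; nothing asserted. [cite: Kato2004Asterisque, Thm 12.6 (p. 222), (14.9.3) (p. 240), Thm 16.6 (2) (p. 271), Prop 17.11 (p. 277), §17.13 (pp. 279–280)]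
[cite: MilneADT2006, Ch. I, Cor. 2.3] -/
theorem zetaColemanMuIotaNegDiscAtTwo_of_honestLocalDualPairs_negDisc : ZetaColemanMuIotaNegDiscAtTwo := by
  intro W _ _ _ _ _ N _ f κ γ hκ hord h2 hΔ hγ hγ' hf D Y
  obtain ⟨I, G, v₂, hv₂, P₀, instP₀, instP₀', S, instS, ψm, ψ, toDualP, col, φ, ℓ₀, hG, hP, hψ₁, hψ₂, hcol, hφ, hφ₁,
    hrecG, herl⟩ := hhonestNeg W f κ γ hκ hord h2 hΔ hγ hγ' hf D
  obtain ⟨Z, P, ℓ, τ, π, h⟩ := zetaColemanMuTheta_invol_datum_of_localDualPair_locOne_erl D Y I G hG v₂ hv₂ hP ψ hψ₁ hψ₂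
    col hcol φ hφ hφ₁ ℓ₀ hrecG herl
  exact ⟨I, Z, P, ℓ, τ, π, h⟩

end HonestNeg

/-- **The SIGN-FREE honest supply of p693362 also gives F1μι⁻ BY NAME** (monotone: forget the `0 < Δ` curves;
`zetaColemanMuTheta_invol_of_honestLocalDualPairs` then the lead's `zetaColemanMuIotaNegDiscAtTwo_of_iota_signFree`). On `0 < Δ` the
sign-free supply's `‖r‖₂ = 1` clause has no Kato witness (F-27a), so this door is recorded for completeness only. Kernel; nothing asserted.
[cite: Kato2004Asterisque, Thm 16.2 (p. 269), 17.5 (p. 274), §17.13 (pp. 279–280)] -/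
theorem zetaColemanMuIotaNegDiscAtTwo_of_honestLocalDualPairs
    (hhonest : ∀ (W : WeierstrassCurve ℚ) [W.IsElliptic] [W.IsGloballyMinimal]
      [ContinuousSMul ℤ_[2] (W.tateModule 2)] [Module.Free ℤ_[2] (W.tateModule 2)]
      [Module.Finite ℤ_[2] (W.tateModule 2)] {N : ℕ} [NeZero N] (f : CuspForm (Gamma0 N) 2)
      (κ : ZpExtension ℚ 2) (γ : absoluteGaloisGroup ℚ) (hκ : κ.IsCyclotomic),
      IsOrdinaryAt W 2 → W.HasSurjectiveModNGaloisRep 2 →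
      κ.IsTopGenerator γ → IsCyclotomicVariable 2 γ → IsNewformOf W f →
      ∀ (D : W.SelmerDualData κ γ),
        ∃ (I : IwasawaH1Data W 2 κ γ) (G : Set I.H)
          (v₂ : HeightOneSpectrum (𝓞 ℚ)) (_ : ((2 : ℕ) : 𝓞 ℚ) ∈ v₂.asIdeal)
          (P₀ : Type) (_ : AddCommGroup P₀) (_ : Module (IwasawaAlgebra 2) P₀)
          (S : Type) (_ : AddCommGroup S) (ψm ψ : AddMonoid.End S) (toDualP : P₀ →+ (S →+ AddCircle (1 : ℚ)))
          (col : P₀ →ₗ[IwasawaAlgebra 2] IwasawaAlgebra 2) (φ : W.selmerInfty κ →+ S)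
          (ℓ₀ : I.H →ₗ[IwasawaAlgebra 2] P₀),
          (∀ g ∈ G, IsEulerSystemClassTwo W hκ I g) ∧
          IsDualPair 2 ψm toDualP ∧ (1 + ψm) * (1 + ψ) = 1 ∧ (1 + ψ) * (1 + ψm) = 1 ∧
          Function.Injective col ∧
          (∀ s, φ ((W.conjSelmerInfty κ γ - 1) s) = ψ (φ s)) ∧
          (∀ s : W.selmerInfty κ, φ s = 0 ↔
            W.resOfLe 2 (inf_le_left : κ.kerSubgroup ⊓ decomp v₂ ≤ κ.kerSubgroup)
              (s : W.subgroupH1 2 κ.kerSubgroup) = 0) ∧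
          (∀ g ∈ G, ∀ s : W.selmerInfty κ, toDualP (ℓ₀ g) (φ s) = 0) ∧
          ∃ g ∈ G, ∃ (u : (IwasawaAlgebra 2)ˣ) (M L' : IwasawaAlgebra 2) (r : ℚ_[2]),
            M ∉ IwasawaAlgebra.augIdealP 2 ∧ ‖r‖ = 1 ∧
              iwasawaToPowerSeries 2 L' = PowerSeries.C r * padicLFunction f (unitRoot W 2 : ℚ_[2]) ∧
              col (ℓ₀ g) = (u : IwasawaAlgebra 2) * M * L') :
    ZetaColemanMuIotaNegDiscAtTwo :=
  zetaColemanMuIotaNegDiscAtTwo_of_iota_signFree (zetaColemanMuTheta_invol_of_honestLocalDualPairs hhonest)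

/-! ## §2 Consequences BY NAME on the `Δ < 0` cell from the honest `Δ < 0` supply -/

section Consequences

variable (hhonestNeg : ∀ (W : WeierstrassCurve ℚ) [W.IsElliptic] [W.IsGloballyMinimal]
    [ContinuousSMul ℤ_[2] (W.tateModule 2)] [Module.Free ℤ_[2] (W.tateModule 2)]
    [Module.Finite ℤ_[2] (W.tateModule 2)] {N : ℕ} [NeZero N] (f : CuspForm (Gamma0 N) 2)
    (κ : ZpExtension ℚ 2) (γ : absoluteGaloisGroup ℚ) (hκ : κ.IsCyclotomic),
    IsOrdinaryAt W 2 → W.HasSurjectiveModNGaloisRep 2 → W.Δ < 0 →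
    κ.IsTopGenerator γ → IsCyclotomicVariable 2 γ → IsNewformOf W f →
    ∀ (D : W.SelmerDualData κ γ),
      ∃ (I : IwasawaH1Data W 2 κ γ) (G : Set I.H)
        (v₂ : HeightOneSpectrum (𝓞 ℚ)) (_ : ((2 : ℕ) : 𝓞 ℚ) ∈ v₂.asIdeal)
        (P₀ : Type) (_ : AddCommGroup P₀) (_ : Module (IwasawaAlgebra 2) P₀)
        (S : Type) (_ : AddCommGroup S) (ψm ψ : AddMonoid.End S) (toDualP : P₀ →+ (S →+ AddCircle (1 : ℚ)))
        (col : P₀ →ₗ[IwasawaAlgebra 2] IwasawaAlgebra 2) (φ : W.selmerInfty κ →+ S)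
        (ℓ₀ : I.H →ₗ[IwasawaAlgebra 2] P₀),
        (∀ g ∈ G, IsEulerSystemClassTwo W hκ I g) ∧
        IsDualPair 2 ψm toDualP ∧ (1 + ψm) * (1 + ψ) = 1 ∧ (1 + ψ) * (1 + ψm) = 1 ∧
        Function.Injective col ∧
        (∀ s, φ ((W.conjSelmerInfty κ γ - 1) s) = ψ (φ s)) ∧
        (∀ s : W.selmerInfty κ, φ s = 0 ↔
          W.resOfLe 2 (inf_le_left : κ.kerSubgroup ⊓ decomp v₂ ≤ κ.kerSubgroup)
            (s : W.subgroupH1 2 κ.kerSubgroup) = 0) ∧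
        (∀ g ∈ G, ∀ s : W.selmerInfty κ, toDualP (ℓ₀ g) (φ s) = 0) ∧
        ∃ g ∈ G, ∃ (u : (IwasawaAlgebra 2)ˣ) (M L' : IwasawaAlgebra 2) (r : ℚ_[2]),
          M ∉ IwasawaAlgebra.augIdealP 2 ∧ ‖r‖ = 1 ∧
            iwasawaToPowerSeries 2 L' = PowerSeries.C r * padicLFunction f (unitRoot W 2 : ℚ_[2]) ∧
            col (ℓ₀ g) = (u : IwasawaAlgebra 2) * M * L')

include hhonestNeg in
/-- **`μ(X(E/ℚ_∞)) = 0` for every cyclotomic Selmer dual datum at a curve of the cell [good ordinary at `2`, `ρ̄₂` onto, `Δ < 0`],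
from the honest `Δ < 0` supply** (the core Theorem A at `2` on `Δ < 0` is the THEOREM p669276, inside the lead's
`mu_eq_zero_of_iotaNegDisc`). [cite: Kato2004Asterisque, §17.13 (pp. 279–280)] [cite: GreenbergLNM1716, Conj. 1.11 (p. 64) (shape)] -/
theorem mu_eq_zero_of_honestLocalDualPairs_negDisc
    (W : WeierstrassCurve ℚ) [W.IsElliptic] [W.IsGloballyMinimal]
    (hgo : GoodOrd W 2) (h2 : W.HasSurjectiveModNGaloisRep 2) (hΔ : W.Δ < 0)
    {N : ℕ} [NeZero N] (f : CuspForm (Gamma0 N) 2) (hf : IsNewformOf W f)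
    (κ : ZpExtension ℚ 2) (γ : absoluteGaloisGroup ℚ) (hκ : κ.IsCyclotomic) (hγ : κ.IsTopGenerator γ)
    (hγ' : IsCyclotomicVariable 2 γ) (D : W.SelmerDualData κ γ) : D.mu = 0 :=
  mu_eq_zero_of_iotaNegDisc (zetaColemanMuIotaNegDiscAtTwo_of_honestLocalDualPairs_negDisc hhonestNeg)
    W hgo h2 hΔ f hf κ γ hκ hγ hγ' D

include hhonestNeg in
/-- **Kato's `μ`-part `O1.KatoMuPartAtTwo W` on the cell [good ordinary at `2`, `ρ̄₂` onto, `Δ < 0`] from the honest `Δ < 0`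
supply.** [cite: GreenbergLNM1716, Conj. 1.11 (p. 64) (shape)] -/
theorem katoMuPartAtTwo_of_honestLocalDualPairs_negDisc
    (W : WeierstrassCurve ℚ) [W.IsElliptic] [W.IsGloballyMinimal]
    (hgo : GoodOrd W 2) (h2 : W.HasSurjectiveModNGaloisRep 2) (hΔ : W.Δ < 0) :
    O1.KatoMuPartAtTwo W :=
  katoMuPartAtTwo_of_iotaNegDisc (zetaColemanMuIotaNegDiscAtTwo_of_honestLocalDualPairs_negDisc hhonestNeg) W hgo h2 hΔ

include hhonestNeg in
/-- **The crux `OrdKatoHalfAtTwoIso` (stmt-BirchSwinnertonDyer-19573) BY NAME in the P8′ split-glue shape, with the F1 conjunct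
supplied by the honest `Δ < 0` inputs**: `hhonestNeg`, the direct `0 < Δ` child `OrdKatoHalfAtTwoIsoPosDisc`, the print bundle
`PUB ∧ Abbes–Ullmo ∧ Greenberg 5.14@2` (child 23889) and B7′ (child 23921) — through the lead's `ordKatoHalfAtTwoIso_of_iota_halves`.
CONDITIONAL on the displayed hypotheses; nothing closed. [cite: Kato2004Asterisque, Thm. 17.4 (1)(2) (p. 273)]
[cite: GreenbergLNM1716, Prop. 5.14 (p. 130)] [cite: AbbesUllmo1996, Thm. A] -/
theorem ordKatoHalfAtTwoIso_of_honestLocalDualPairs_negDisc_halves (hPos : OrdKatoHalfAtTwoIsoPosDisc)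
    (hbundle : OrdPublishedInputsAtTwo ∧ abbesUllmo_not_dvd_maninConstant_of_not_dvd_level ∧
      Greenberg1999.prop514_isTorsion_mu_eq_zero_two)
    (hB7' : KatoMuPartOff514AtOptimalMemberOfNotSurjectiveTwo) : OrdKatoHalfAtTwoIso :=
  ordKatoHalfAtTwoIso_of_iota_halves (zetaColemanMuIotaNegDiscAtTwo_of_honestLocalDualPairs_negDisc hhonestNeg)
    hPos hbundle hB7'

end Consequences

end Summit.BirchSwinnertonDyer.BirchSwinnertonDyer.Theorems.SteinbergFibreAtTwo

end
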